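/-
HONEST FRAMING: certified error envelopes and provably optimal rounding/accumulation schemes for
low-precision formats under stated cost models; every table by two implementations; no hardware
or vendor claims.
-/
import Summits.Ventures.CertifiedArithmetic.LowPrec.OptDemotionRoutingGH

/-!
# The demotion law (Theorem T8), part 11-8: opt's R37 — the TWO-BIT CHORD (KC), FOR EVERY `q`

opt gen 16 (HOME pub-lowprec-opt/gen16/R36_GH.md §8, request (2)): for `1 ≤ p < p₂ ≤ q-1`,
`p < p' ≤ q-1` with the side condition `p' + (p₂ - p) ≤ q - 1`, and every tree,

  `KC(p, p₂; p'):  (2^-p - u)·(x_{p'} - x_0) ≤ (2^-p' - u)·(x_{(p,p₂)} - x_0)`,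

`x_{p'} = BR_t{0,-p'}`, `x_{(p,p₂)} = BR_t{0,-p,-p₂}`, `x_0 = BR_t{0}`, `u = 2^-q`
(`treeBR_twoBitChord`).  The ratio `(m'-u)/(m-u)` is smaller than (G)'s `(m'-u²)/(m-u²)`; the second
bit `p₂` on the right pays for it.  PROOF (opt): induction on the tree; when the major child keeps
the bit `p'` the node row is the KC row of that child (`kc_keep`); when the minor child receives it
(at its position `r' = q - p'`), the right-hand side is bounded below through the option in which
the minor child receives BOTH bits `p, p₂` (seen at `δ = p₂ - p`, `r = q - p`), and
`gain(r') ≤ ½·gain(r'-1) ≤ ½·gain(δ) ≤ ½·gain(δ, r)` by part 11-7 (G) at `r'-1 < r'` and (M) twice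
(`kc_give`).  So KC is a corollary of (G) + (M), recorded because opt's LP certificates use it as a
packaged row.  opt's validation: 0 violations on 5211 tables + 240 000 node pairs; cone closure of
all KC rows CLOSED at q = 5, 6; referee Round 76 (6281 checks, 0 violations).
-/

namespace Summit.Ventures.CertifiedArithmetic.LowPrec.Opt

open Literature.ComputerArithmetic.JeannerodRump2018
open Literature.ComputerArithmetic.JeannerodRump2018.SumTree

section KC

variable {q : ℕ}

/-- KC, major child keeps the bit `p'`: the node row is the KC row of the major child. -/
theorem kc_keep {u m m' NP N0 aP aP' a0 B0 : ℚ} (hm'u : 0 ≤ m' - u) (hmm' : 0 ≤ m - m')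
    (o1 : 1 + (aP + u * B0) ≤ NP) (o2 : 1 + (a0 + u * B0) ≤ N0)
    (K : (m - u) * aP' ≤ (m' - u) * aP + (m - m') * a0) :
    (m - u) * (1 + (aP' + u * B0)) ≤ (m' - u) * NP + (m - m') * N0 := by
  have f1 := mul_le_mul_of_nonneg_left o1 hm'u
  have f2 := mul_le_mul_of_nonneg_left o2 hmm'
  linear_combination f1 + f2 + K

/-- KC, minor child receives the bit `p'` (value `ρ = 2^-r'` at its position `r' = q - p'`): option
`a_0 + m' b_{r'}`; options `1 + a_0 + m b_{(δ,r)} ≤ N_{(p,p₂)}` (the minor child receives both bits),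
`1 + a_0 + u b_0 ≤ N_0`; (G) on the minor child at `r'-1 < r'` (`(2ρ - u²)(b_{r'} - b_0) ≤
(ρ - u²)(b_{r'-1} - b_0)`) and (M): `b_{r'-1} ≤ b_{(δ,r)}`, `b_0 ≤ b_{(δ,r)}`. -/
theorem kc_give {u m m' ρ NP N0 a0 B0 Br Br1 Bd : ℚ} (hu0 : 0 ≤ u) (hm : 0 ≤ m) (hm'2 : 2 * u ≤ m')
    (hmm' : m' ≤ m) (hρu : u ^ 2 < ρ)
    (o1 : 1 + (a0 + m * Bd) ≤ NP) (o2 : 1 + (a0 + u * B0) ≤ N0)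
    (G : (2 * ρ - u ^ 2) * (Br - B0) ≤ (ρ - u ^ 2) * (Br1 - B0)) (hM1 : Br1 ≤ Bd) (hM3 : B0 ≤ Bd) :
    (m - u) * (1 + (a0 + m' * Br)) ≤ (m' - u) * NP + (m - m') * N0 := by
  have f1 := mul_le_mul_of_nonneg_left o1 (by linarith : 0 ≤ m' - u)
  have f2 := mul_le_mul_of_nonneg_left o2 (sub_nonneg.2 hmm')
  -- `gain(r') ≤ ½ gain(δ, r)`
  have s1 : (2 * ρ - u ^ 2) * (Br - B0) ≤ (ρ - u ^ 2) * (Bd - B0) :=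
    le_trans G (mul_le_mul_of_nonneg_left (by linarith only [hM1]) (by nlinarith))
  have s2 : 2 * (Br - B0) ≤ Bd - B0 := by
    have hsq : 0 ≤ u ^ 2 * (Bd - B0) := mul_nonneg (sq_nonneg u) (sub_nonneg.2 hM3)
    have h : (2 * ρ - u ^ 2) * (2 * (Br - B0)) ≤ (2 * ρ - u ^ 2) * (Bd - B0) := by
      linear_combination 2 * s1 + hsq
    exact le_of_mul_le_mul_left h (by nlinarith)
  -- `(m - u) m' gain(r') ≤ (m' - u) m gain(δ, r)`
  have s3 : (m - u) * m' * (Br - B0) ≤ (m' - u) * m * (Bd - B0) := by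
    have hmu : 0 ≤ m - u := by linarith
    have hm' : 0 ≤ m' := by linarith
    have s3a : (m - u) * m' * (Br - B0) ≤ (m - u) * m' * ((Bd - B0) / 2) :=
      mul_le_mul_of_nonneg_left (by linarith only [s2]) (mul_nonneg hmu hm')
    have hc : (m - u) * m' / 2 ≤ (m' - u) * m := by
      nlinarith [mul_nonneg hm (by linarith : 0 ≤ m' / 2 - u), mul_nonneg hu0 hm']
    have s3b : (m - u) * m' / 2 * (Bd - B0) ≤ (m' - u) * m * (Bd - B0) :=
      mul_le_mul_of_nonneg_right hc (sub_nonneg.2 hM3)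
    have e : (m - u) * m' * ((Bd - B0) / 2) = (m - u) * m' / 2 * (Bd - B0) := by ring
    linarith only [s3a, s3b, e]
  linear_combination f1 + f2 + s3

/-- **opt's R37 (KC), THE TWO-BIT CHORD, every `q ≥ 3`, every tree**: for `1 ≤ p < p₂ ≤ q-1`,
`p < p'`, `p' + (p₂ - p) ≤ q - 1`:
`(2^-p - u)·(BR{0,-p'} - BR{0}) ≤ (2^-p' - u)·(BR{0,-p,-p₂} - BR{0})`. -/
theorem treeBR_twoBitChord (hq : 3 ≤ q) {p p₂ p' : ℕ} (hp : 1 ≤ p) (hpp₂ : p < p₂) (hp₂q : p₂ + 1 ≤ q)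
    (hpp' : p < p') (hside : p' + (p₂ - p) + 1 ≤ q) : ∀ t : SumTree,
    ((2 : ℚ) ^ (-(p : ℤ)) - unitRoundoff q) * (treeBR q t {0, -(p' : ℤ)} - treeBR q t {0}) ≤
      ((2 : ℚ) ^ (-(p' : ℤ)) - unitRoundoff q) * (treeBR q t {0, -(p : ℤ), -(p₂ : ℤ)} - treeBR q t {0}) := by
  classical
  have hq1 : 1 ≤ q := by omega
  have hq2 : 2 ≤ q := by omega
  -- offsets: `δ = p₂ - p`, `r = q - p`, `r' = q - p'`
  obtain ⟨δ, hδ⟩ : ∃ δ : ℕ, (δ : ℤ) = (p₂ : ℤ) - p := ⟨p₂ - p, by omega⟩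
  obtain ⟨r, hr⟩ : ∃ r : ℕ, (r : ℤ) = (q : ℤ) - p := ⟨q - p, by omega⟩
  obtain ⟨r', hr'⟩ : ∃ r' : ℕ, (r' : ℤ) = (q : ℤ) - p' := ⟨q - p', by omega⟩
  have hr'2 : 2 ≤ r' := by omega
  have hδr' : δ + 1 ≤ r' := by omega
  set u := unitRoundoff q with hudef
  set m : ℚ := (2 : ℚ) ^ (-(p : ℤ)) with hmdef
  set m' : ℚ := (2 : ℚ) ^ (-(p' : ℤ)) with hm'def
  set ρ : ℚ := (2 : ℚ) ^ (-(r' : ℤ)) with hρdef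
  have huz : u = (2 : ℚ) ^ (-(q : ℤ)) := unitRoundoff_eq_zpow q
  have hu0 : 0 < u := by rw [huz]; exact zpow_pos (by norm_num) _
  have hu4 : u ≤ 1 / 4 := by
    rw [huz, show (1 / 4 : ℚ) = (2 : ℚ) ^ (-2 : ℤ) by norm_num]
    exact zpow_le_zpow_right₀ (by norm_num) (by omega)
  have pw : ∀ a b : ℤ, (2 : ℚ) ^ (a + b) = (2 : ℚ) ^ a * (2 : ℚ) ^ b := fun a b =>
    zpow_add₀ (by norm_num) a b
  have two_mul_zpow : ∀ x : ℤ, (2 : ℚ) * (2 : ℚ) ^ x = (2 : ℚ) ^ (x + 1) := fun x => by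
    rw [zpow_add_one₀ (by norm_num)]; ring
  have hm0 : 0 < m := zpow_pos (by norm_num) _
  have hmm' : m' ≤ m := zpow_le_zpow_right₀ (by norm_num) (by omega)
  have hm'2 : 2 * u ≤ m' := by
    rw [huz, hm'def, two_mul_zpow]; exact zpow_le_zpow_right₀ (by norm_num) (by omega)
  have hρ2 : 2 * u ≤ ρ := by
    rw [huz, hρdef, two_mul_zpow]; exact zpow_le_zpow_right₀ (by norm_num) (by omega)
  have hρu : u ^ 2 < ρ := by nlinarith
  have hmu : 0 < m - u := by linarith
  have hm'ρ : m' * ρ = u := by rw [hm'def, hρdef, ← pw, huz]; congr 1; omega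
  have p2ρ : (2 : ℚ) ^ (-(((r' - 1 : ℕ) : ℤ))) = 2 * ρ := by
    rw [hρdef, two_mul_zpow]; congr 1; omega
  have n0 : ∀ (X : SumTree) (T : Finset ℤ), 0 ≤ treeBR q X T := fun X T => treeBR_nonneg q X T
  -- options
  have optkeep : ∀ (X Y : SumTree),
      1 + (treeBR q X {0, -(p : ℤ), -(p₂ : ℤ)} + u * treeBR q Y {0}) ≤ treeBR q (.node X Y) {0, -(p : ℤ), -(p₂ : ℤ)} := by
    intro X Y
    have h := (treeBR_triple_node_ge hq1 X Y (a := p) (b := p₂) hp hpp₂ hp₂q).1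
    rw [treeBR_single_shift Y (-(q : ℤ)), ← huz] at h
    exact h
  have optgive : ∀ (X Y : SumTree),
      1 + (treeBR q X {0} + m * treeBR q Y {0, -(δ : ℤ), -(r : ℤ)}) ≤ treeBR q (.node X Y) {0, -(p : ℤ), -(p₂ : ℤ)} := by
    intro X Y
    have h := (treeBR_triple_node_ge hq1 X Y (a := p) (b := p₂) hp hpp₂ hp₂q).2.2.2
    have e : ({-(p : ℤ), -(p₂ : ℤ), -(q : ℤ)} : Finset ℤ) = {0 + -(p : ℤ), -(δ : ℤ) + -(p : ℤ), -(r : ℤ) + -(p : ℤ)} := by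
      ext z; simp only [Finset.mem_insert, Finset.mem_singleton]; omega
    rw [e, treeBR_triple_shift'] at h
    exact h
  have optzero : ∀ (X Y : SumTree), 1 + (treeBR q X {0} + u * treeBR q Y {0}) ≤ treeBR q (.node X Y) {0} := by
    intro X Y
    have h := injected_le_treeBR_node_top hq1 X Y (e₀ := 0) (T := (∅ : Finset ℤ))
      (fun t ht => absurd ht (Finset.notMem_empty t)) (P := ∅) (Finset.empty_subset _)
    rw [zpow_zero, Finset.sdiff_self, Finset.insert_empty, Finset.insert_empty, zero_sub,
      treeBR_single_shift Y (-(q : ℤ)), ← huz] at h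
    exact h
  -- rows on the minor child: (G) at `r'-1 < r'` and (M)
  have rowG : ∀ Y : SumTree, (2 * ρ - u ^ 2) * (treeBR q Y {0, -(r' : ℤ)} - treeBR q Y {0}) ≤
      (ρ - u ^ 2) * (treeBR q Y {0, -(((r' - 1 : ℕ) : ℤ))} - treeBR q Y {0}) := by
    intro Y
    have h := treeBR_phantomChord hq2 (p := r' - 1) (p' := r') (by omega) (by omega) (by omega) Y
    rw [p2ρ] at h
    exact h
  have rowM1 : ∀ Y : SumTree, treeBR q Y {0, -(((r' - 1 : ℕ) : ℤ))} ≤ treeBR q Y {0, -(δ : ℤ), -(r : ℤ)} := by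
    intro Y
    have h1 : treeBR q Y {0, -(((r' - 1 : ℕ) : ℤ))} ≤ treeBR q Y {0, -(δ : ℤ)} := by
      refine treeBR_mono hq1 Y (Finset.insert_nonempty _ _) (Finset.insert_nonempty _ _)
        (routable_zero_pair (by omega) (by omega)) (routable_zero_pair (by omega) (by omega)) ?_
      rw [val_pair (by omega), val_pair (by omega)]
      have : (2 : ℚ) ^ (-(((r' - 1 : ℕ) : ℤ))) ≤ (2 : ℚ) ^ (-(δ : ℤ)) := zpow_le_zpow_right₀ (by norm_num) (by omega)
      linarith
    have h2 : treeBR q Y {0, -(δ : ℤ)} ≤ treeBR q Y {0, -(δ : ℤ), -(r : ℤ)} :=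
      treeBR_le_of_subset_of_bounds hq1 Y (lo := 1 - (q : ℤ))
        (by intro z hz; simp only [Finset.mem_insert, Finset.mem_singleton] at hz ⊢; omega)
        (by intro z hz; simp only [Finset.mem_insert, Finset.mem_singleton] at hz; omega)
    exact h1.trans h2
  have rowM3 : ∀ Y : SumTree, treeBR q Y {0} ≤ treeBR q Y {0, -(δ : ℤ), -(r : ℤ)} := fun Y =>
    treeBR_le_of_subset_of_bounds hq1 Y (lo := 1 - (q : ℤ))
      (by intro z hz; simp only [Finset.mem_insert, Finset.mem_singleton] at hz ⊢; omega)
      (by intro z hz; simp only [Finset.mem_insert, Finset.mem_singleton] at hz; omega)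
  ------------------------------------------------------------------ the induction
  intro t
  induction t with
  | leaf z => simp [treeBR]
  | node A B ihA ihB =>
  set NP := treeBR q (.node A B) {0, -(p : ℤ), -(p₂ : ℤ)} with hNP
  set NP' := treeBR q (.node A B) {0, -(p' : ℤ)} with hNP'
  set N0 := treeBR q (.node A B) {0} with hN0
  -- `NP' ≤ 1 + R` with `(m - u)(1 + R) = (m' - u) NP + (m - m') N0`
  set R : ℚ := ((m' - u) * NP + (m - m') * N0) / (m - u) - 1 with hRdef
  have toR : ∀ V : ℚ, (m - u) * (1 + V) ≤ (m' - u) * NP + (m - m') * N0 → V ≤ R := by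
    intro V h
    rw [hRdef, le_sub_iff_add_le, le_div_iff₀ hmu]
    linarith only [h]
  have hNP1 : 1 ≤ NP := by
    have := optkeep A B; linarith only [this, n0 A {0, -(p : ℤ), -(p₂ : ℤ)}, mul_nonneg hu0.le (n0 B {0})]
  have hN01 : 1 ≤ N0 := by
    have := optzero A B; linarith only [this, n0 A {0}, mul_nonneg hu0.le (n0 B {0})]
  have hR : 0 ≤ R := by
    refine toR 0 ?_
    have h1 := mul_le_mul_of_nonneg_left hNP1 (by linarith : 0 ≤ m' - u)
    have h2 := mul_le_mul_of_nonneg_left hN01 (sub_nonneg.2 hmm')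
    linarith only [h1, h2]
  have core : ∀ (X Y : SumTree),
      (m - u) * (treeBR q X {0, -(p' : ℤ)} - treeBR q X {0}) ≤ (m' - u) * (treeBR q X {0, -(p : ℤ), -(p₂ : ℤ)} - treeBR q X {0}) →
      1 + (treeBR q X {0, -(p : ℤ), -(p₂ : ℤ)} + u * treeBR q Y {0}) ≤ NP →
      1 + (treeBR q X {0} + m * treeBR q Y {0, -(δ : ℤ), -(r : ℤ)}) ≤ NP →
      1 + (treeBR q X {0} + u * treeBR q Y {0}) ≤ N0 →
      treeBR q X {0, -(p' : ℤ)} + treeBR q Y {-(q : ℤ)} ≤ R ∧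
        treeBR q X {0} + treeBR q Y {-(p' : ℤ), -(q : ℤ)} ≤ R := by
    intro X Y KX ok og oz
    constructor
    · rw [treeBR_single_shift, ← huz]
      exact toR _ (kc_keep (by linarith) (sub_nonneg.2 hmm') ok oz (by linarith only [KX]))
    · have e : ({-(p' : ℤ), -(q : ℤ)} : Finset ℤ) = {0 + -(p' : ℤ), -(r' : ℤ) + -(p' : ℤ)} := by
        ext z; simp only [Finset.mem_insert, Finset.mem_singleton]; omega
      rw [e, treeBR_pair_shift']
      exact toR _ (kc_give hu0.le hm0.le hm'2 hmm' hρu og oz (rowG Y) (rowM1 Y) (rowM3 Y))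
  have hab := core A B ihA (optkeep A B) (optgive A B) (optzero A B)
  have hba := core B A ihB
    (by have h := optkeep B A; rw [treeBR_node_comm A B] at h; exact h)
    (by have h := optgive B A; rw [treeBR_node_comm A B] at h; exact h)
    (by have h := optzero B A; rw [treeBR_node_comm A B] at h; exact h)
  have key := treeBR_pair_node_le hq1 A B (i := p') (by omega) (by omega) hR
    (max_le (max_le hab.1 hab.2) (max_le hba.1 hba.2))
  have e : (m - u) * (1 + R) = (m' - u) * NP + (m - m') * N0 := by
    rw [hRdef]; field_simp; ring
  have := mul_le_mul_of_nonneg_left key hmu.le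
  rw [e] at this
  linarith only [this]

end KC

end Summit.Ventures.CertifiedArithmetic.LowPrec.Opt
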